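import Summits.Schanuel.Schanuel.Theorems.RootDecomp1KArcCell02

/-!
# RootDecomp1KArcCell — lens 1, generation 50, node 9 «THE ARC ENGINE: separation by positive-dimensional containment; members ρ° = Π(1+4^(−k!)) and the twin σ° = Π(1+2·4^(−k!)); item 33364 decided hyp-free at zA = (1, ℓ₂, ρ°), zD = (1, ρ°, σ°) and π-twins» — continuation (RootDecomp1KArcCell03): §4a (E3) TruncGenericSeq and the re-plumbed extraction engine

(lens-1 g50 HOME kernel K = HOME/decomp-schanuel-lens-1/g50/ArcCell.lean 10f1e0d5…, 3410 l · 258 decl lines, imports …RootDecomp1KCollarWall05 + …RootDecomp1KCommonRadixCell04 + …RootDecomp1KNWMeasureHolds BY NAME; P ArcCellProbe.lean af7624ff… rc 0 / C₀ ArcCellCtrl0.lean d71f613e… rc 0 / C ArcCellCtrl.lean 242a3b02… rc 1 = 42 planted; memo NODE-g50.md; CLAIM L2466, EX-ANTE PRICE + CHECKLIST K-g50 L2467, NODE L2469 / REQUEST L2470 (with the lens's ex-post self-correction: both members fall to printed dominance in substance — zA directly by Bundschuh LNM 1415 p.78 / Zhu 推论 1.3.3, zD after τ = σ°/ρ°²);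 critic VERDICT L2473: CLEARED AS PRICED EX ANTE — ONE CELL ×1 «ARC CELL (TYPED-LEVEL)» with the SUBSTANCE CAVEAT OF RECORD (both members inside the archimedean dominance class in substance; E2 convenient, not necessary), RULE K-R39 FIXED, PORT GO. Port by census-1 gen 21 as `RootDecomp1KArcCell01–13` along K's §1–§12 with §4, §7 and §12 cut at decl boundaries by the 400-line file cap: 01 = §1 (E1) `aeval_one_div_two_pow_ne_zero` (dyadic root lemma) + §2 (E2) `toPolyPoly`, `arc_count` (a relation contains ≤ deg q of an injective family of rational arcs — roots over the domain ℚ[X]); 02 = §3 (A) the member: `dfac`, `arcNum`, `arcProdQ` (ρ°_N), `sQ`, `rhoArc` (ρ° = Π(1 + 4^(−k!))) and its tails; 03 = §4a (E3) `TruncGenericSeq` («[class] definition» tag) + **`algebraicIndependent_of_truncGenericSeq`** (the g36/g37 extraction re-plumbed to arbitrary dyadic-type schedules); 04 = §4b `psQ`, the link `truncGeneric_iff_truncGenericSeq` and the tree (X′) re-derived — K's `theorem algebraicIndependent_liouville_of_truncGeneric'` DEMOTED to a documented `example` (its statement is byte-identical to the tree's `RootDecomp1KCommonRadixCell.algebraicIndependent_liouville_of_truncGeneric`,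 CommonRadixCell03 l.98 — dedup twin flagged by the writer L2472 (α), demotion pre-sanctioned by the critic L2473; nothing in K uses the primed name); 05 = §5 the arcs of ρ°: `arcPoly`, `arcF`, `arcBasis`, `arcScal`, `clearArc`, `truncGenericSeq_arc`, tightness `qArc` / `qArc_tight`; 06 = §6 the arc cell `algebraicIndependent_arc_of_mvPolyMeasure`, `algebraicIndependent_rhoArc_ell2`, walls `sb_arcWall3(_pi)`, item-shape instances + §7 head `zA` / `zApi`, `linearIndependent_zA(pi)`, `linLiouville_zA(pi)`; 07 = §7a the ONE 2-adic cut `cutA` + **`form_lower_bound_A`** (exponent 9), `not_hyperLinLiouville_zA(pi)` (m₀ = 10), `sb_zA(pi)`, `finiteOrderLiouvilleSchanuel_at_zA(pi)`, `item33364_at_zA(pi)`, `item31077_at_zA`; 08 = §8 `rhoArc_position` (11 conjuncts by tree name) and its lemmas, `liouville_rhoArc`; 09 = §9 (A′) the twin σ° = Π(1 + 2·4^(−k!)): `arcNum2`, `arcOdd2`, `arcProdQ2`, `sigmaArc`, `liouville_sigmaArc`; 10 = §10 the lines of (ρ°, σ°): `linPoly`, `linF`, `linBasis`, `linScal`, `clearLin`,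 `truncGenericSeq_lin`, `qLin` / `qLin_tight`; 11 = §11 the twin cell `algebraicIndependent_twin_of_mvPolyMeasure`, walls `sb_twinWall3(_pi)`, item-shape instances + §12 head `zD` / `zDpi`, binders; 12 = §12a part 1 the archimedean two-level cut `cutD`, `cutD_succ_ne_zero`, `cutD_height_bound`; 13 = §12a part 2 **`form_lower_bound_D`** (exponent 7), `not_hyperLinLiouville_zD(pi)` (m₀ = 8), `sb_zD(pi)`, `item33364_at_zD(pi)`, `zD_shape`. PORT EDITS (census convention): `set_option linter.dupNamespace false` dropped; 77 one-line helper docstrings added (statements quoted); per-part private helper copies; sections `Extraction` / `Members` / `TwinMembers` closed and re-opened across the cuts with their `variable` / `open` lines; statements and proofs otherwise verbatim (no renames; K's own private markers kept). `--supports stmt-Schanuel-33364`; no census credit carried; rung 0 — nothing here proves Schanuel; no ∀-item moves; 33364, 33363, 31077 stay OPEN.)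
-/

noncomputable section

open Polynomial LiouvilleNumber
open scoped Nat

namespace Summit.Schanuel.Schanuel.Theorems.RootDecomp1KArcCell

open Summit.Schanuel.Schanuel.Theorems.RootDecomp1KCollarCell
open Summit.Schanuel.Schanuel.Theorems.RootDecomp1KGapCell
open Summit.Schanuel.Schanuel.Theorems.RootDecomp1KTwoBaseCell
open Summit.Schanuel.Schanuel.Theorems.RootDecomp1KRelLiouvilleCell
open Summit.Schanuel.Schanuel.Theorems.RootDecomp1KNWMeasureHolds (polyMeasure_exp_one_holds)
open Summit.Schanuel.Schanuel.Theorems.RootDecomp1KHyper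
open Summit.Schanuel.Schanuel.Theorems.RootDecomp1KHyper.HyperCell
open Summit.Schanuel.Schanuel.Theorems.RootDecomp1KCommonRadixCell (TruncGeneric algebraicIndependent_liouville_of_truncGeneric)

/-! ## §4  (E3) DYADIC EXTRACTION (X‴) — truncation-generic dyadic approximants × a block of polynomial measure -/
section Extraction

variable {k n : ℕ}

/-- [class] definition (membership predicate with parameters, NOT a fact; census convention): **TRUNCATION-GENERICITY**
of a sequence of rational approximant tuples `x(N) = (x_i(N))_i`: no non-zero integer polynomial vanishes at `x(N)` for all
large `N` (the JOIN hypothesis of the g37 theorem (X″), freed from the partial sums of standard Liouville numbers; linked back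
to the tree's `RootDecomp1KCommonRadixCell.TruncGeneric` by `truncGeneric_iff_truncGenericSeq`). -/
def TruncGenericSeq (x : Fin k → ℕ → ℚ) : Prop :=
  ∀ q : MvPolynomial (Fin k) ℤ, q ≠ 0 → ∀ N₀ : ℕ, ∃ N, N₀ ≤ N ∧ MvPolynomial.aeval (fun i => x i N) q ≠ 0

/-- `mvlen (c·X^m) ≤ |c|` (re-proof of the private tree helper TwoBaseCell03 `mvlen_monomial_le'`). -/
private theorem mvlen_monomial_le' (m : Fin n →₀ ℕ) (c : ℤ) : mvlen (MvPolynomial.monomial m c) ≤ |c| := by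
  classical
  rw [mvlen_eq_sum_of_support_subset _ MvPolynomial.support_monomial_subset, Finset.sum_singleton,
    MvPolynomial.coeff_monomial, if_pos rfl]

/-- Subadditivity of `mvlen` (re-proof of the private tree helper TwoBaseCell03 `mvlen_add_le'`). -/
private theorem mvlen_add_le' (P Q : MvPolynomial (Fin n) ℤ) : mvlen (P + Q) ≤ mvlen P + mvlen Q := by
  classical
  have hs : (P + Q).support ⊆ P.support ∪ Q.support := MvPolynomial.support_add
  rw [mvlen_eq_sum_of_support_subset _ hs,
    mvlen_eq_sum_of_support_subset P (Finset.subset_union_left (s₂ := Q.support)),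
    mvlen_eq_sum_of_support_subset Q (Finset.subset_union_right (s₁ := P.support)),
    ← Finset.sum_add_distrib]
  exact Finset.sum_le_sum fun m _ => by rw [MvPolynomial.coeff_add]; exact abs_add_le _ _

/-- `mvlen (Σ F_i) ≤ Σ mvlen F_i` (re-proof of the private tree helper TwoBaseCell03 `mvlen_sum_le'`). -/
private theorem mvlen_sum_le' {ι : Type*} (s : Finset ι) (F : ι → MvPolynomial (Fin n) ℤ) :
    mvlen (∑ i ∈ s, F i) ≤ ∑ i ∈ s, mvlen (F i) := by
  classical
  induction s using Finset.induction_on with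
  | empty => simp [mvlen]
  | insert a s ha ih =>
    rw [Finset.sum_insert ha, Finset.sum_insert ha]
    exact (mvlen_add_le' _ _).trans (by linarith)

/-- **(E3) THE EXTRACTION THEOREM (X‴) FOR APPROXIMANT SEQUENCES.**  Let `ξ₁, …, ξ_k ∈ ℝ` admit rational
approximants `x_i(N)` with denominators AT MOST `2^{A·N!}`, bounded by `B`, of precision `|ξ_i − x_i(N)| ≤ c / 2^{(N+1)!}`,
forming a TRUNCATION-GENERIC sequence; let `θ⃗` have polynomial measure of algebraic independence in every degree
(`MvPolyMeasure`, tree Hyper03).  Then `(ξ⃗, θ⃗)` is algebraically independent over `ℚ`.  (The extraction of tree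
CommonRadixCell03 `algebraicIndependent_liouville_of_truncGeneric` (X′) RE-PLUMBED from `partialSum (b i) N` to arbitrary
bounded-denominator approximants — BOOKKEEPING, no new idea; (X′) is re-derived from it VERBATIM below
(`algebraicIndependent_liouville_of_truncGeneric'`): a relation `P(ξ, θ) = 0` is pushed to `P(x(N), θ)`, which is
`2^{-(N+1)!}`-small by the Lipschitz bound (tree `norm_aeval_sub_aeval_le`), but is a NON-ZERO (truncation-genericity
supplies the `θ`-coefficient) integer polynomial in `θ⃗` of height `2^{O(N!)}` after clearing denominators, hence not
smaller than `2^{-O(N!)}` by the measure; tree `growth_beats` ends it.  Engine parts BY NAME: tree TwoBaseCell03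
`algebraicIndependent_of_forall_int'`, `norm_aeval_sub_aeval_le`, `growth_beats`, TwoBaseCell04 `lpart`/`tpart`/
`eq_of_parts_eq`, Hyper03 `mvlen`; private re-proofs `mvlen_monomial_le'`/`mvlen_add_le'`/`mvlen_sum_le'` of their
private tree twins.) -/
theorem algebraicIndependent_of_truncGenericSeq {ξ : Fin k → ℝ} {x : Fin k → ℕ → ℚ} {A : ℕ} {B c : ℝ}
    (hB1 : 1 ≤ B) (hc0 : 0 ≤ c)
    (hden : ∀ i N, (x i N).den ≤ 2 ^ (A * N !)) (hB : ∀ i N, |(x i N : ℝ)| ≤ B)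
    (hc : ∀ i N, |ξ i - x i N| ≤ c / 2 ^ (N + 1)!) (hgen : TruncGenericSeq x)
    {θ : Fin n → ℂ} (hθ : MvPolyMeasure θ) :
    AlgebraicIndependent ℚ (Sum.elim (fun i => ((ξ i : ℝ) : ℂ)) θ : Fin k ⊕ Fin n → ℂ) := by
  classical
  refine algebraicIndependent_of_forall_int' fun P hP0 hPval => ?_
  -- degree and measure
  set d : ℕ := P.totalDegree with hd
  obtain ⟨C, τ, hC, hmeas⟩ := hθ d
  have hdeg : ∀ e ∈ P.support, ∑ y, e y ≤ d := fun e he => by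
    have h1 := MvPolynomial.le_totalDegree he
    rwa [Finsupp.sum_fintype _ _ (fun _ => rfl)] at h1
  have hdegl : ∀ e ∈ P.support, ∀ i, e (Sum.inl i) ≤ d := fun e he i => by
    refine le_trans ?_ (hdeg e he)
    exact Finset.single_le_sum (f := fun y => e y) (fun _ _ => Nat.zero_le _) (Finset.mem_univ _)
  have hdegL : ∀ e ∈ P.support, ∑ i, e (Sum.inl i) ≤ d := fun e he => by
    refine le_trans ?_ (hdeg e he)
    rw [Fintype.sum_sum_type]; exact Nat.le_add_right _ _
  have hdegT : ∀ e ∈ P.support, ∑ j, e (Sum.inr j) ≤ d := fun e he => by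
    refine le_trans ?_ (hdeg e he)
    rw [Fintype.sum_sum_type]; exact Nat.le_add_left _ _
  -- (a) the coefficient polynomial `q = Q_{α₀}` of one `θ`-monomial `α₀`
  obtain ⟨e₀, he₀⟩ := MvPolynomial.support_nonempty.mpr hP0
  set α₀ : Fin n →₀ ℕ := tpart e₀ with hα₀
  set S₀ : Finset (Fin k ⊕ Fin n →₀ ℕ) := P.support.filter (fun e => tpart e = α₀) with hS₀
  have he₀S₀ : e₀ ∈ S₀ := Finset.mem_filter.mpr ⟨he₀, rfl⟩
  set q : MvPolynomial (Fin k) ℝ :=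
    ∑ e ∈ S₀, MvPolynomial.monomial (lpart e) ((P.coeff e : ℤ) : ℝ) with hq
  have hq0 : q ≠ 0 := by
    intro h
    have hce : q.coeff (lpart e₀) = ((P.coeff e₀ : ℤ) : ℝ) := by
      rw [hq, MvPolynomial.coeff_sum, Finset.sum_eq_single e₀]
      · rw [MvPolynomial.coeff_monomial, if_pos rfl]
      · intro e he hne
        rw [MvPolynomial.coeff_monomial, if_neg]
        intro hl
        exact hne (eq_of_parts_eq hl ((Finset.mem_filter.mp he).2.trans rfl))
      · intro h0; exact absurd he₀S₀ h0
    rw [h, MvPolynomial.coeff_zero] at hce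
    exact (MvPolynomial.mem_support_iff.mp he₀) (by exact_mod_cast hce.symm)
  -- (a') its integer model `qZ`, to which truncation-genericity applies
  set qZ : MvPolynomial (Fin k) ℤ := ∑ e ∈ S₀, MvPolynomial.monomial (lpart e) (P.coeff e) with hqZ
  have hqmap : MvPolynomial.map (Int.castRingHom ℝ) qZ = q := by
    rw [hqZ, hq, map_sum]
    refine Finset.sum_congr rfl fun e _ => ?_
    rw [MvPolynomial.map_monomial, eq_intCast]
  have hqZ0 : qZ ≠ 0 := by
    intro h; apply hq0; rw [← hqmap, h, map_zero]
  -- (b) constants (independent of the level `N`)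
  set L : ℝ := ∑ e ∈ P.support, |((P.coeff e : ℤ) : ℝ)| with hL
  have hL0 : 0 ≤ L := Finset.sum_nonneg fun _ _ => abs_nonneg _
  set R : ℝ := B + c + 1 + ∑ j, ‖θ j‖ with hR
  have hθsum : 0 ≤ ∑ j, ‖θ j‖ := Finset.sum_nonneg fun _ _ => norm_nonneg _
  have hR1 : 1 ≤ R := by linarith
  have hBR : B ≤ R := by linarith
  have hBcR : B + c ≤ R := by linarith
  have hθR : ∀ j, ‖θ j‖ ≤ R := fun j => by
    have : ‖θ j‖ ≤ ∑ j, ‖θ j‖ :=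
      Finset.single_le_sum (f := fun j => ‖θ j‖) (fun _ _ => norm_nonneg _) (Finset.mem_univ j)
    linarith
  have hB0 : 0 ≤ B := by linarith
  set G : ℕ := 2 ^ (A * d * k * (τ + 1)) with hG
  have hGpos : 0 < G := pow_pos (by norm_num) _
  set A₀ : ℝ := C * (B ^ d * L) ^ τ * (L * (d * R ^ d * c)) with hA₀
  -- (c) the level `N`: SUPPLIED BY TRUNCATION-GENERICITY beyond the two growth thresholds
  obtain ⟨N, hNN₁, hqN⟩ := hgen qZ hqZ0 (max G ⌈A₀⌉₊)
  have hNG : G ≤ 2 ^ N := le_trans (le_trans (le_max_left _ _) hNN₁) Nat.lt_two_pow_self.le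
  have hNA : A₀ < 2 ^ N := by
    have h1 : A₀ ≤ ⌈A₀⌉₊ := Nat.le_ceil _
    have h2 : (⌈A₀⌉₊ : ℝ) ≤ (N : ℝ) := by exact_mod_cast le_trans (le_max_right _ _) hNN₁
    have h3 : ((N : ℕ) : ℝ) < 2 ^ N := by exact_mod_cast Nat.lt_two_pow_self
    linarith
  -- (d) the approximants `x_i(N) = p_i / Bq_i` (lowest terms, `Bq_i ≤ 2^{A N!}`) and the precision
  set Bq : Fin k → ℕ := fun i => (x i N).den with hBq
  set p : Fin k → ℤ := fun i => (x i N).num with hpdef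
  have hBqpos : ∀ i, (0 : ℝ) < (Bq i : ℝ) := fun i => by
    have := (x i N).den_pos
    exact_mod_cast this
  have hBq_le : ∀ i, (Bq i : ℝ) ≤ (2 : ℝ) ^ (A * N !) := fun i => by exact_mod_cast hden i N
  set s : Fin k → ℝ := fun i => ((x i N : ℚ) : ℝ) with hs
  have hsp : ∀ i, s i = (p i : ℝ) / (Bq i : ℝ) := fun i => by
    show ((x i N : ℚ) : ℝ) = ((x i N).num : ℝ) / ((x i N).den : ℝ)
    rw [Rat.cast_def]
  have hs_abs : ∀ i, |s i| ≤ B := fun i => hB i N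
  have hp_le : ∀ i, |(p i : ℝ)| ≤ B * Bq i := fun i => by
    have e : (p i : ℝ) = s i * Bq i := by rw [hsp i, div_mul_cancel₀ _ (hBqpos i).ne']
    rw [e, abs_mul, abs_of_pos (hBqpos i)]
    exact mul_le_mul_of_nonneg_right (hs_abs i) (hBqpos i).le
  set δ : ℝ := c / (2 : ℝ) ^ (N + 1)! with hδ
  have hδ0 : 0 ≤ δ := by positivity
  have hδc : δ ≤ c := by
    rw [hδ]
    refine div_le_self hc0 ?_
    exact one_le_pow₀ (by norm_num)
  have hdiff : ∀ i, |s i - ξ i| ≤ δ := fun i => by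
    rw [abs_sub_comm]; exact hc i N
  have hξ_abs : ∀ i, |ξ i| ≤ B + c := fun i => by
    have h1 := hdiff i
    have h2 := hs_abs i
    have h3 : |ξ i| ≤ |s i| + |s i - ξ i| := by
      have := abs_sub_abs_le_abs_sub (ξ i) (s i)
      rw [abs_sub_comm] at this; linarith
    linarith
  -- (e) the integer polynomial `H = D · P(x(N), X)` in the `θ`-variables
  set cf : (Fin k ⊕ Fin n →₀ ℕ) → ℤ := fun e =>
    P.coeff e * ∏ i, ((p i) ^ e (Sum.inl i) * (Bq i : ℤ) ^ (d - e (Sum.inl i))) with hcf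
  set H : MvPolynomial (Fin n) ℤ := ∑ e ∈ P.support, MvPolynomial.monomial (tpart e) (cf e) with hH
  set D : ℝ := ∏ i : Fin k, (Bq i : ℝ) ^ d with hD
  have hD0 : 0 < D := Finset.prod_pos fun i _ => pow_pos (hBqpos i) _
  -- (e1) the coefficients of `H`, as reals
  have hc_cast : ∀ e ∈ P.support,
      ((cf e : ℤ) : ℝ) = ((P.coeff e : ℤ) : ℝ) * D * ∏ i, s i ^ e (Sum.inl i) := by
    intro e he
    rw [hcf]; push_cast
    rw [hD, mul_assoc, ← Finset.prod_mul_distrib]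
    congr 1
    refine Finset.prod_congr rfl fun i _ => ?_
    obtain ⟨t, ht⟩ := Nat.exists_eq_add_of_le (hdegl e he i)
    have hB' : (Bq i : ℝ) ^ e (Sum.inl i) ≠ 0 := pow_ne_zero _ (hBqpos i).ne'
    rw [hsp i, ht, Nat.add_sub_cancel_left, pow_add, div_pow, mul_div_assoc', eq_div_iff hB']
    ring
  have hc_abs : ∀ e ∈ P.support, |((cf e : ℤ) : ℝ)| ≤ |((P.coeff e : ℤ) : ℝ)| * (B ^ d * D) := by
    intro e he
    rw [hcf]; push_cast
    rw [abs_mul, Finset.abs_prod]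
    refine mul_le_mul_of_nonneg_left ?_ (abs_nonneg _)
    have hterm : ∀ i, |(p i : ℝ) ^ e (Sum.inl i) * (Bq i : ℝ) ^ (d - e (Sum.inl i))| ≤
        B ^ e (Sum.inl i) * (Bq i : ℝ) ^ d := by
      intro i
      rw [abs_mul, abs_pow, abs_pow, abs_of_pos (hBqpos i)]
      obtain ⟨t, ht⟩ := Nat.exists_eq_add_of_le (hdegl e he i)
      rw [ht, Nat.add_sub_cancel_left, pow_add, ← mul_assoc]
      refine mul_le_mul_of_nonneg_right ?_ (by positivity)
      rw [← mul_pow]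
      exact pow_le_pow_left₀ (abs_nonneg _) (hp_le i) _
    calc ∏ i, |(p i : ℝ) ^ e (Sum.inl i) * (Bq i : ℝ) ^ (d - e (Sum.inl i))|
        ≤ ∏ i, B ^ e (Sum.inl i) * (Bq i : ℝ) ^ d :=
          Finset.prod_le_prod (fun i _ => abs_nonneg _) fun i _ => hterm i
      _ = B ^ (∑ i, e (Sum.inl i)) * D := by
          rw [Finset.prod_mul_distrib, Finset.prod_pow_eq_pow_sum, hD]
      _ ≤ B ^ d * D := by
          refine mul_le_mul_of_nonneg_right ?_ hD0.le
          exact pow_le_pow_right₀ hB1 (hdegL e he)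
  -- (e2) the value: `H(θ) = D · P(x(N), θ)`
  set xs : Fin k ⊕ Fin n → ℂ := Sum.elim (fun i => ((s i : ℝ) : ℂ)) θ with hxs
  set xl : Fin k ⊕ Fin n → ℂ := Sum.elim (fun i => ((ξ i : ℝ) : ℂ)) θ with hxl
  have hHval : MvPolynomial.aeval θ H = (D : ℂ) * MvPolynomial.aeval xs P := by
    rw [hH, map_sum, MvPolynomial.aeval_def xs, MvPolynomial.eval₂_eq', Finset.mul_sum]
    refine Finset.sum_congr rfl fun e he => ?_
    rw [MvPolynomial.aeval_monomial, Finsupp.prod_fintype _ _ (fun _ => pow_zero _),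
      Fintype.prod_sum_type]
    simp only [tpart_apply, hxs, Sum.elim_inl, Sum.elim_inr, algebraMap_int_eq, eq_intCast]
    have h1 : ((cf e : ℤ) : ℂ) = (((cf e : ℤ) : ℝ) : ℂ) := by push_cast; rfl
    rw [h1, hc_cast e he]
    push_cast
    ring
  -- (e3) `H ≠ 0`: its `α₀`-coefficient is `D · q(x(N)) ≠ 0` — THIS is where truncation-genericity enters
  have hH0 : H ≠ 0 := by
    intro h0
    have hcoef : H.coeff α₀ = ∑ e ∈ S₀, cf e := by
      rw [hH, MvPolynomial.coeff_sum, hS₀, Finset.sum_filter]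
      refine Finset.sum_congr rfl fun e _ => ?_
      rw [MvPolynomial.coeff_monomial]
    have hsum : (((∑ e ∈ S₀, cf e : ℤ)) : ℝ) = D * MvPolynomial.eval s q := by
      rw [hq, map_sum]
      push_cast
      rw [Finset.mul_sum]
      refine Finset.sum_congr rfl fun e he => ?_
      have heS : e ∈ P.support := (Finset.mem_filter.mp he).1
      rw [MvPolynomial.eval_monomial, Finsupp.prod_fintype _ _ (fun _ => pow_zero _)]
      simp only [lpart_apply]
      rw [hc_cast e heS]
      ring
    have hq_ne : MvPolynomial.eval s q ≠ 0 := by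
      intro h0'
      apply hqN
      have e1 : ((MvPolynomial.aeval (fun i => x i N) qZ : ℚ) : ℝ) =
          MvPolynomial.eval s (MvPolynomial.map (Int.castRingHom ℝ) qZ) := by
        rw [MvPolynomial.eval_map, ← algebraMap_int_eq, ← MvPolynomial.aeval_def,
          ← Rat.coe_castHom, map_aeval_int]
        rfl
      rw [hqmap] at e1
      rw [h0'] at e1
      exact_mod_cast e1
    have : (((∑ e ∈ S₀, cf e : ℤ)) : ℝ) = 0 := by
      rw [← hcoef, h0, MvPolynomial.coeff_zero]; push_cast; rfl
    rw [hsum] at this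
    rcases mul_eq_zero.mp this with hD' | hq'
    · exact absurd hD' hD0.ne'
    · exact hq_ne hq'
  -- (e4) degree and length of `H`
  have hHdeg : H.totalDegree ≤ d := by
    rw [hH]
    refine MvPolynomial.totalDegree_finsetSum_le fun e he => ?_
    refine (MvPolynomial.totalDegree_monomial_le _ _).trans ?_
    rw [Finsupp.sum_fintype _ _ (fun _ => rfl)]
    simp only [tpart_apply, id]
    exact hdegT e he
  have hHlen : (mvlen H : ℝ) ≤ B ^ d * D * L := by
    have h1 : mvlen H ≤ ∑ e ∈ P.support, |cf e| := by
      rw [hH]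
      refine (mvlen_sum_le' _ _).trans (Finset.sum_le_sum fun e _ => mvlen_monomial_le' _ _)
    have h2 : (mvlen H : ℝ) ≤ ∑ e ∈ P.support, |((cf e : ℤ) : ℝ)| := by
      have := (Int.cast_le (R := ℝ)).mpr h1; push_cast at this; exact this
    refine h2.trans ?_
    rw [hL, Finset.mul_sum]
    refine Finset.sum_le_sum fun e he => ?_
    calc |((cf e : ℤ) : ℝ)| ≤ |((P.coeff e : ℤ) : ℝ)| * (B ^ d * D) := hc_abs e he
      _ = B ^ d * D * |((P.coeff e : ℤ) : ℝ)| := by ring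
  have hHlen0 : (0 : ℝ) ≤ mvlen H := by exact_mod_cast mvlen_nonneg H
  -- (f) the measure at `H`
  have hM := hmeas H hH0 hHdeg
  rw [hHval, norm_mul, Complex.norm_real, Real.norm_eq_abs, abs_of_pos hD0] at hM
  -- (g) the Lipschitz upper bound: `‖P(x(N), θ)‖ = ‖P(x(N), θ) − P(ξ, θ)‖ ≤ L d R^d δ`
  have hval0 : MvPolynomial.aeval xl P = 0 := hPval
  have hx : ∀ y, ‖xs y‖ ≤ R := by
    intro y; cases y with
    | inl i => simp only [hxs, Sum.elim_inl, Complex.norm_real, Real.norm_eq_abs]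
               exact (hs_abs i).trans hBR
    | inr j => simp only [hxs, Sum.elim_inr]; exact hθR j
  have hy : ∀ y, ‖xl y‖ ≤ R := by
    intro y; cases y with
    | inl i => simp only [hxl, Sum.elim_inl, Complex.norm_real, Real.norm_eq_abs]
               exact (hξ_abs i).trans hBcR
    | inr j => simp only [hxl, Sum.elim_inr]; exact hθR j
  have hxy : ∀ y, ‖xs y - xl y‖ ≤ δ := by
    intro y; cases y with
    | inl i => simp only [hxs, hxl, Sum.elim_inl]
               rw [← Complex.ofReal_sub, Complex.norm_real, Real.norm_eq_abs]; exact hdiff i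
    | inr j => simp only [hxs, hxl, Sum.elim_inr, sub_self, norm_zero]; exact hδ0
  have hLip := norm_aeval_sub_aeval_le P hR1 hδ0 hx hy hxy (le_refl d)
  rw [hval0, sub_zero] at hLip
  -- (h) combine: `1 ≤ A₀ · D^{τ+1} / 2^{(N+1)!}` and `D^{τ+1} ≤ G^{N!}`, impossible beyond the thresholds
  have hA₀0 : 0 ≤ A₀ := by rw [hA₀]; positivity
  have hDpow : D ^ (τ + 1) ≤ (G : ℝ) ^ N ! := by
    have h1 : D ≤ ∏ _i : Fin k, ((2 : ℝ) ^ (A * N !)) ^ d :=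
      Finset.prod_le_prod (fun i _ => pow_nonneg (hBqpos i).le _)
        fun i _ => pow_le_pow_left₀ (hBqpos i).le (hBq_le i) _
    have h2 : (∏ _i : Fin k, ((2 : ℝ) ^ (A * N !)) ^ d) ^ (τ + 1) = (G : ℝ) ^ N ! := by
      rw [Finset.prod_const, Finset.card_univ, Fintype.card_fin, hG]
      push_cast
      ring
    rw [← h2]
    exact pow_le_pow_left₀ hD0.le h1 _
  have hchain : (1 : ℝ) ≤ A₀ * (G : ℝ) ^ N ! / 2 ^ (N + 1)! := by
    have h1 : (1 : ℝ) ≤ C * (B ^ d * D * L) ^ τ * (D * (L * (d * R ^ d * δ))) := by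
      calc (1 : ℝ) ≤ C * (mvlen H : ℝ) ^ τ * (D * ‖MvPolynomial.aeval xs P‖) := hM
        _ ≤ C * (B ^ d * D * L) ^ τ * (D * ‖MvPolynomial.aeval xs P‖) := by gcongr
        _ ≤ C * (B ^ d * D * L) ^ τ * (D * (L * (d * R ^ d * δ))) := by gcongr
    have h2 : C * (B ^ d * D * L) ^ τ * (D * (L * (d * R ^ d * δ))) =
        A₀ * D ^ (τ + 1) / 2 ^ (N + 1)! := by
      rw [hA₀, hδ]; ring
    rw [h2] at h1
    refine h1.trans ?_
    have hpos2 : (0 : ℝ) < 2 ^ (N + 1)! := by positivity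
    exact div_le_div_of_nonneg_right (mul_le_mul_of_nonneg_left hDpow hA₀0) hpos2.le
  have hlt := growth_beats (A₀ := A₀) hNG hNA
  have hpos : (0 : ℝ) < 2 ^ (N + 1)! := by positivity
  rw [le_div_iff₀ hpos, one_mul] at hchain
  linarith

end Extraction

end Summit.Schanuel.Schanuel.Theorems.RootDecomp1KArcCell

end
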